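import Summits.Ventures.YMGap.RobustBall.TorusClustering
import Summits.Ventures.YMGap.YM3IR.Clustering
import HarnessLib

/-!
# Venture YMGap, track ROBUST-BALL (Y2) → track YM3-IR (Y4): the receiving conjecture
`YM3IR.ClusterDomainClustering` DISCHARGED for the robust ball in `d = 3`

HONEST FRAMING. WHAT THIS IS: a venture file (cell `pub-ymgap`, seat ds-2) — the Y2 ↔ Y4 seam in the kernel. Y4's
`YM3IR/Clustering.lean` types the currency its infrared theorem consumes: a `BallSpec G N` (representation `ρ`,
Wilson-part ceiling `β⋆`, a membership predicate `InBall`) and the `@[conjecture]`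
`ClusterDomainClustering B r m_c` = ONE constant `A` such that every member law `μ = W.perturbedMeasure ρ β'`
(`0 ≤ β' ≤ β⋆`, `InBall M W`) on every torus of side `M ≥ 3` clusters at rate `m_c` in the link metric `r`. Here
that conjecture is PROVED, for `G = SU(N)`, `ρ` fundamental, `r = suFrobDist`, and `InBall` = membership in the
cell's typed balls: (i) from `TorusClusteringOnBallUpTo N 3 β⋆ ε₀ ε₁ r A m` (tier 1, `ClusterDomainFR ε₀ ε₁ r`) —
`clusterDomainClustering_of_torusClusteringOnBallUpTo`; (ii) from the tier-2 statements `TorusClusteringOnBallW`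
uniformly in `β' ≤ β⋆` (`ClusterDomain κ ε₀ ε₁`, the diameter-weighted ball Y4 hands over) —
`clusterDomainClustering_of_torusClusteringOnBallW`; and (iii) HYPOTHESIS-FREE IN THE BALL DATA from any one-link
modulus `OneLinkKRModulus N R K` BY NAME on the radius `R ≥ 4β⋆/N` of the `d = 3` torus link fields:
`clusterDomainClustering_of_oneLinkKRModulus` (tier 1, rate `−log ρ⋆/(r ⊔ 1)`, `ρ⋆ = rhoFR N (12 K β⋆/N) ε₀ ε₁ < 1`)
and `clusterDomainClusteringW_of_oneLinkKRModulus` (tier 2, rate `κ`, `rhoFR N (12 e^{κ} K β⋆/N) ε₀ ε₁ < 1`). The two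
`ClustersWith` bodies (Y2's `RobustBall.ClustersWith`, Y4's `YM3IR.ClustersWith`) differ only in the order of the two
Lipschitz sums. WHAT THIS IS NOT: nothing about Bałaban's UV theorem, the block maps or the crossover (Y4's other
hypotheses); no continuum statement; a strong-coupling (`β' ≤ β⋆` small) lattice statement — no Millennium claim.

## References
* The tree: `YM3IR/Clustering.lean` (ym3ir-theory-2: `BallSpec`, `BallSpec.Mem`, `ClusterDomainClustering`),
  `RobustBall/TorusClustering.lean` (this seat). K. Osterwalder, E. Seiler, Ann. Phys. 110 (1978) 440, §3 (the
  Wilson member, in print).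
-/

noncomputable section

open MeasureTheory ProbabilityTheory Finset Function Real
open Literature.Probability.LatticeModels Literature.Probability.LatticeModels.DobrushinMetric
open Literature.MathematicalPhysics.QuantumLattice hiding torusNorm
open Literature.MathematicalPhysics.QuantumFieldTheory hiding ZdEdge
open Literature.MathematicalPhysics.QuantumFieldTheory.Balaban1983to89.StrongCouplingDobrushinWindow
  (OneLinkKRModulus)

namespace Summit.Ventures.YMGap.RobustBall

variable {d N : ℕ}

/-- The two clustering bodies agree: Y2's `RobustBall.ClustersWith W β A m` gives Y4's
`YM3IR.ClustersWith suFrobDist μ_{β,W,M} A m` (the Lipschitz sums commute). [folklore] -/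
theorem ym3ir_clustersWith_of_clustersWith {M : ℕ} [NeZero M] {W : Perturbation d M N} {β A m : ℝ}
    (h : ClustersWith W β A m) :
    YM3IR.ClustersWith suFrobDist (W.perturbedMeasure (fundamentalRep (Fin N)) β) A m := by
  intro f g Δf Δg δf δg n hf hg hdf hdg hbf hbg hlf hlg hsep
  have h1 := h f g Δf Δg δf δg n hf hg hdf hdg hbf hbg hlf hlg hsep
  calc |cov[f, g; W.perturbedMeasure (fundamentalRep (Fin N)) β]|
      ≤ A * (∑ y ∈ Δg, δg y) * (∑ x ∈ Δf, δf x) * Real.exp (-m * n) := h1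
    _ = A * (∑ x ∈ Δf, δf x) * (∑ y ∈ Δg, δg y) * Real.exp (-m * n) := by ring

/-- **Y4's receiving conjecture from the tier-1 currency.** `TorusClusteringOnBallUpTo N 3 β⋆ ε₀ ε₁ r A m` gives
`ClusterDomainClustering` for the ball spec (fundamental `SU(N)`, ceiling `β⋆`, membership in
`ClusterDomainFR ε₀ ε₁ r`) at rate `m`. [folklore] -/
theorem clusterDomainClustering_of_torusClusteringOnBallUpTo {βs ε₀ ε₁ A m : ℝ} {r : ℕ}
    (h : TorusClusteringOnBallUpTo N 3 βs ε₀ ε₁ r A m) :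
    YM3IR.ClusterDomainClustering (G := SUN N)
      ⟨fundamentalRep (Fin N), βs, fun _ _ W => W ∈ ClusterDomainFR ε₀ ε₁ r⟩ suFrobDist m := by
  refine ⟨A, fun M _ hM μ hμ => ?_⟩
  obtain ⟨β', hβ0, hβs, W, hW, rfl⟩ := hμ
  exact ym3ir_clustersWith_of_clustersWith (h β' hβ0 hβs M hM W hW)

/-- **Y4's receiving conjecture from the tier-2 currency** (the diameter-weighted ball Y4 hands over): tier-2
clustering uniformly in `0 ≤ β' ≤ β⋆` gives `ClusterDomainClustering` for membership in `ClusterDomain κ ε₀ ε₁`. [folklore] -/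
theorem clusterDomainClustering_of_torusClusteringOnBallW {βs κ ε₀ ε₁ A m : ℝ}
    (h : ∀ β : ℝ, 0 ≤ β → β ≤ βs → TorusClusteringOnBallW N 3 β κ ε₀ ε₁ A m) :
    YM3IR.ClusterDomainClustering (G := SUN N)
      ⟨fundamentalRep (Fin N), βs, fun _ _ W => W ∈ ClusterDomain κ ε₀ ε₁⟩ suFrobDist m := by
  refine ⟨A, fun M _ hM μ hμ => ?_⟩
  obtain ⟨β', hβ0, hβs, W, hW, rfl⟩ := hμ
  exact ym3ir_clustersWith_of_clustersWith (h β' hβ0 hβs M hM W hW)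

/-- **Y4's receiving conjecture, tier 1, from a one-link modulus BY NAME** (`N ≥ 1`): a modulus
`OneLinkKRModulus N R K` on the radius `R ≥ 4β⋆/N` of the `d = 3` torus link fields and a certified row
`ρ⋆ = rhoFR N (12 K β⋆/N) ε₀ ε₁ ∈ (0, 1)` give `ClusterDomainClustering` on `ClusterDomainFR ε₀ ε₁ r` up to `β⋆` at rate
`−log ρ⋆/(r ⊔ 1)` (constant `8N`). [folklore] -/
theorem clusterDomainClustering_of_oneLinkKRModulus (hN : 1 ≤ N) {βs ε₀ ε₁ R K : ℝ} (hK : 0 ≤ K)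
    (hR : βs / N * 4 ≤ R) (hmod : OneLinkKRModulus N R K) (hε₀ : 0 ≤ ε₀) (hε₁ : 0 ≤ ε₁) (r : ℕ)
    (hρ0 : 0 < rhoFR N (K * (βs / N) * 12) ε₀ ε₁) (hρ1 : rhoFR N (K * (βs / N) * 12) ε₀ ε₁ < 1) :
    YM3IR.ClusterDomainClustering (G := SUN N)
      ⟨fundamentalRep (Fin N), βs, fun _ _ W => W ∈ ClusterDomainFR ε₀ ε₁ r⟩ suFrobDist
      (-Real.log (rhoFR N (K * (βs / N) * 12) ε₀ ε₁) / max r 1) := by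
  have e4 : (2 : ℝ) * (((3 : ℕ) : ℝ) - 1) = 4 := by norm_num
  have e12 : (6 : ℝ) * (((3 : ℕ) : ℝ) - 1) = 12 := by norm_num
  have h := torusClusteringOnBallUpTo_of_oneLinkKRModulus (d := 3) (N := N) (by norm_num) hN hK
    (βs := βs) (R := R) (by rw [e4]; exact hR) hmod hε₀ hε₁ r (by rw [e12]; exact hρ0) (by rw [e12]; exact hρ1)
  rw [e12] at h
  exact clusterDomainClustering_of_torusClusteringOnBallUpTo h

/-- **Y4's receiving conjecture, tier 2, from a one-link modulus BY NAME** (`N ≥ 1`, `κ ≥ 0`, `β⋆ ≥ 0`): on the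
diameter-weighted ball `ClusterDomain κ ε₀ ε₁` up to Wilson ceiling `β⋆`, rate `κ`, whenever
`rhoFR N (12 e^{κ} K β⋆/N) ε₀ ε₁ < 1`. [folklore] -/
theorem clusterDomainClusteringW_of_oneLinkKRModulus (hN : 1 ≤ N) {βs κ ε₀ ε₁ R K : ℝ} (hK : 0 ≤ K) (hκ : 0 ≤ κ)
    (hR : βs / N * 4 ≤ R) (hmod : OneLinkKRModulus N R K) (hε₀ : 0 ≤ ε₀) (hε₁ : 0 ≤ ε₁)
    (hρ1 : rhoFR N (Real.exp κ * K * (βs / N) * 12) ε₀ ε₁ < 1) :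
    YM3IR.ClusterDomainClustering (G := SUN N)
      ⟨fundamentalRep (Fin N), βs, fun _ _ W => W ∈ ClusterDomain κ ε₀ ε₁⟩ suFrobDist κ := by
  refine clusterDomainClustering_of_torusClusteringOnBallW (A := 8 * N) fun β hβ0 hββs => ?_
  have hN0 : (0 : ℝ) < N := by exact_mod_cast (show 0 < N by omega)
  have hβabs : |β| = β := abs_of_nonneg hβ0
  have e4 : (2 : ℝ) * (((3 : ℕ) : ℝ) - 1) = 4 := by norm_num
  have e12 : (6 : ℝ) * (((3 : ℕ) : ℝ) - 1) = 12 := by norm_num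
  have hRβ : |β| / N * (2 * (((3 : ℕ) : ℝ) - 1)) ≤ R := by
    rw [e4, hβabs]
    exact le_trans (mul_le_mul_of_nonneg_right (div_le_div_of_nonneg_right hββs hN0.le) (by norm_num)) hR
  have hcW : Real.exp κ * K * (|β| / N) * (6 * (((3 : ℕ) : ℝ) - 1)) ≤ Real.exp κ * K * (βs / N) * 12 := by
    rw [e12, hβabs]
    exact mul_le_mul_of_nonneg_right (mul_le_mul_of_nonneg_left (div_le_div_of_nonneg_right hββs hN0.le)
      (mul_nonneg (Real.exp_pos _).le hK)) (by norm_num)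
  exact torusClusteringOnBallW_of_oneLinkKRModulus (d := 3) (by norm_num) hN hK hκ hRβ hmod hε₀ hε₁
    (lt_of_le_of_lt (rhoFR_mono hcW hε₁) hρ1)

end Summit.Ventures.YMGap.RobustBall

end
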